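import Literature.AlgebraicGeometry.Frobenioids.BirationalizationIsFrobenioid
import Literature.AlgebraicGeometry.Frobenioids.BirationalizationBiratData
import Literature.AlgebraicGeometry.Frobenioids.PreFrobenioidDataRoundTrip
import HarnessLib

/-!
# Frobenioids I, Proposition 4.4 (ii) (2024 form): "`C^birat` is a Frobenioid" in the interface shape
# `IsFrobenioid (biratData hF hsq).ops.toFunctor` consumed by the §5 sub-DAG slots

Mochizuki, *The geometry of Frobenioids I: the general theory*, Kyushu J. Math. **62** (2008)
293–400, §4, Proposition 4.4 (ii), kurims text p. 83 [cite: MochizukiFrdI2008, Prop. 4.4 (ii) p.83], in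
the author's corrected 2024 form (*Comments on [FrdI]* (29)(i)): for `C` of (isotropic and) birationally
Frobenius-normalized type, `C^birat → F_{0_D}` is a Frobenioid — PROVED for THE birationalization as
`PreFrobenioid.Birat.isFrobenioid` (`BirationalizationIsFrobenioid.lean`, row W14, seat abc-iut-w5-d227).

PROOF-ONLY file (abc-iut cell, seat abc-iut-w5-d227). The sub-DAG slots of [FrdI] §5 (abc-iut-L6-t6's
`Prop55Sub.lean`: `Prop55ii_birat`, `Prop55iii_*`, …; the perfection/birationalization commutation
files) take the Frobenioid-ness of `C^birat` as the hypothesis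
`hBi : IsFrobenioid (biratData hF (hasBiratSquares_of_isFrobenioid hF)).ops.toFunctor` — the operations
`(biratData hF hsq).ops = biratOps hF hsq = ofFunctor 0_D (Birat.toElemZero hF hsq)` of abc-iut-L6-t6's
datum read back as a functor (Def. 1.1 (iv) round trip). By abc-iut-L6-t20's
`PreFrobenioid.isFrobenioid_toFunctor_ofFunctor_iff` (`PreFrobenioidDataRoundTrip.lean`, `Iff.rfl`) this
is DEFINITIONALLY `IsFrobenioid (Birat.toElemZero hF hsq)`; the two theorems below state `hBi` literally,
for `C` of isotropic and birationally Frobenius-normalized (resp. model) type. No definitions; nothing here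
concerns the disputed parts of IUT.
-/

namespace Literature.AlgebraicGeometry.Frobenioids

open CategoryTheory Opposite

universe w v v' u u'

namespace PreFrobenioid

variable {D : Type u} [Category.{v} D] {Φ : Dᵒᵖ ⥤ CommMonCat.{w}}
  {C : Type u'} [Category.{v'} C] {F : C ⥤ ElemFrobenioid Φ}

/-- **`hBi` discharged** (isotropic + birationally Frobenius-normalized type): the operations of THE
birationalization datum, read back as a functor, form a Frobenioid.
[cite: MochizukiFrdI2008, Prop. 4.4 (ii) p.83] -/
theorem isFrobenioid_biratData_ops_toFunctor (hF : IsFrobenioid F) (hsq : HasBiratSquares F)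
    (hiso : IsOfIsotropicType F) (hbfn : ∀ A : C, IsBiratFrobeniusNormalized F hF hsq A) :
    IsFrobenioid (biratData hF hsq).ops.toFunctor :=
  (isFrobenioid_toFunctor_ofFunctor_iff (Birat.toElemZero hF hsq)).mpr
    (Birat.isFrobenioid hF hsq hiso hbfn)

/-- **`hBi` discharged, in the literal shape of the §5 slots** (`hsq := hasBiratSquares_of_isFrobenioid hF`),
for `C` of isotropic and birationally Frobenius-normalized type. [cite: MochizukiFrdI2008, Prop. 4.4 (ii) p.83] -/
theorem isFrobenioid_biratData_ops_toFunctor' (hF : IsFrobenioid F) (hiso : IsOfIsotropicType F)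
    (hbfn : ∀ A : C, IsBiratFrobeniusNormalized F hF (hasBiratSquares_of_isFrobenioid hF) A) :
    IsFrobenioid (biratData hF (hasBiratSquares_of_isFrobenioid hF)).ops.toFunctor :=
  isFrobenioid_biratData_ops_toFunctor hF _ hiso hbfn

/-- **`hBi` discharged for Frobenioids of isotropic and MODEL type** (Def. 4.5 (i), abc-iut-L6-t8's
`IsOfModelType`). [cite: MochizukiFrdI2008, Prop. 4.4 (ii) p.83] -/
theorem isFrobenioid_biratData_ops_toFunctor_of_isOfModelType (hF : IsFrobenioid F)
    (hsq : HasBiratSquares F) (hiso : IsOfIsotropicType F) (hmod : IsOfModelType F hF hsq) :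
    IsFrobenioid (biratData hF hsq).ops.toFunctor :=
  isFrobenioid_biratData_ops_toFunctor hF hsq hiso hmod.2

end PreFrobenioid

end Literature.AlgebraicGeometry.Frobenioids
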